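import Mathlib
import Summits.ResolutionOfSingularities.ResolutionOfSingularities.Theorems.WeightedInvariantLocalWeightedDropTOT2BridgePresentedSucc
import Summits.ResolutionOfSingularities.ResolutionOfSingularities.Theorems.WeightedInvariantLocalWeightedDropTOT2BridgePresentedExit
import Summits.ResolutionOfSingularities.ResolutionOfSingularities.Theorems.WeightedInvariantLocalWeightedDropPolyDescentSelDefs
import Summits.ResolutionOfSingularities.ResolutionOfSingularities.Theorems.WeightedInvariantLocalWeightedDropNCResSettingAdmissible

/-!
# TOT2-LINE v1.3, regime (P): the DECORATED STEP of the lazy strategy — the two CURVE branches (res-L1-w43-stub-2 g5, work order (P2c))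

Sub-problem `ResolutionOfSingularities`, ENGINE crux `stmt-ResolutionOfSingularities-8899` (`LocalWeightedDrop`), inner tame loop
at `m + 1 = 3`, S-ASM by regimes (res-L1-w43-lead-1 g5 memo TOT2-LINE v1.3 §3 (P2)). A PRESENTED STATE is an admissible decorated
state `(b, δ)` with a point-B-permissible presentation `Φ₀` (`IsBPermissible δ Φ₀ 𝟙`: legal, boundary-straightening), a unit `U` and
a label `A` of degree `d` in the polygon regime (`PolyDescent.InPoly d A`) with `Φ₀(δ.f · ∏_{O} x_l) = U · monicGerm d A`, carrying
the invariant «a boundary letter straightened to `y` is OLD» (`∀ l ∈ δ.E, strIdx Φ₀ l = y → l ∈ δ.O`).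

This file plays ONE step of the LAZY strategy `PolyDescent.succTWP` (…PolyDescentSelDefs) in its two CURVE branches
(`V(y,u₁)` / `V(y,u₂)` permissible) and reads every answer of the opponent: far answer (`γ ≠ 0`) ⇒ the order letter drops to `0`
(head drop); near answer with smaller head ⇒ head drop; near answer with the same head ⇒ the successor is PRESENTED by the lazy successor
label `A′ ∈ succTWP d A` (…TOT2BridgePresentedSucc), and either `A′` is again in the polygon regime (continue) or the successor is in the
APEX COLUMN `HCol` (…TOT2BridgePresentedExit). Helpers: the order letter of a presented state is the degree (`Decoration.c_eq_of_presentation`)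
and the propagation of the old-letter invariant (`Decoration.old_of_strIdx_last_transform`).

All statements are ours (engine bookkeeping); nothing here is a statement of [CJS] or [CP-char2].
-/

set_option linter.dupNamespace false -- mandated namespace of this single-conjunct summit

noncomputable section

namespace Summit.ResolutionOfSingularities.ResolutionOfSingularities.Theorems

namespace TameFourTupleDrop

open MvPowerSeries Literature.AlgebraicGeometry.Resolution

variable {k : Type} [Field k]

section Helpers

variable {b : MvPowerSeries (Fin (2 + 1)) k} {δ : Decoration k 2} {Θ : Fin (2 + 1) → MvPowerSeries (Fin (2 + 1)) k}
  {H : MvPowerSeries (Fin (2 + 1)) k} {d : ℕ} {A : Fin d → MvPowerSeries (Fin 2) k}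

/-- **THE ORDER LETTER OF A PRESENTED STATE IS THE DEGREE OF ITS LABEL** (label a position: `IsPosT`). -/
theorem Decoration.c_eq_of_presentation (hadm : Admissible b δ) (hΘ0 : ∀ i, constantCoeff (Θ i) = 0)
    (hΘdet : IsUnit (FormalCoordChange.linMat Θ).det) (hH : constantCoeff H ≠ 0)
    (hpres : subst Θ (δ.f * ∏ l ∈ δ.O, X l) = H * NCPoly.monicGerm d A) (hA : PolyDescent.IsPosT d A) : δ.c = d := by
  have h1 := order_monicForm_of_presentation hadm hΘ0 hΘdet hH hpres
  have h2 := WildUnaryConeMonic.order_monicForm A hA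
  change (NCPoly.monicGerm d A).order = _ at h2
  rw [h1] at h2
  exact_mod_cast h2

/-- Same head ⇒ same order letter (as in …NCResCurveGraphStep, restated to keep the import cone small). -/
theorem Decoration.o_transform_eq_of_head_eq' {Φ : Fin (2 + 1) → MvPowerSeries (Fin (2 + 1)) k} {w : Fin (2 + 1) → ℕ}
    {c : Fin (2 + 1) → k} {i : Fin (2 + 1)} (hhead : (δ.transform Φ w c i).head = δ.head) : (δ.transform Φ w c i).o = δ.o := by
  unfold Decoration.head at hhead
  exact (Prod.ext_iff.mp (toLex_inj.mp hhead)).1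

/-- Same head ⇒ same `c` letter. -/
theorem Decoration.c_transform_eq_of_head_eq' {Φ : Fin (2 + 1) → MvPowerSeries (Fin (2 + 1)) k} {w : Fin (2 + 1) → ℕ}
    {c : Fin (2 + 1) → k} {i : Fin (2 + 1)} (hhead : (δ.transform Φ w c i).head = δ.head) : (δ.transform Φ w c i).c = δ.c := by
  unfold Decoration.head at hhead
  exact (Prod.ext_iff.mp (toLex_inj.mp hhead)).2

/-- Same head ⇒ the old letters of the successor are the through-going old letters. -/
theorem Decoration.O_transform_eq_of_head_eq' {Φ : Fin (2 + 1) → MvPowerSeries (Fin (2 + 1)) k} {w : Fin (2 + 1) → ℕ}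
    {c : Fin (2 + 1) → k} {i : Fin (2 + 1)} (hhead : (δ.transform Φ w c i).head = δ.head) :
    (δ.transform Φ w c i).O = Decoration.newLetters δ.O Φ c i := by
  refine Decoration.transform_O_of_not_lt _ _ _ _ _ ?_
  rw [← Decoration.transform_o, Decoration.o_transform_eq_of_head_eq' hhead]
  exact lt_irrefl _

/-- In three variables: the through-going index of a letter straightened to `x_s` after slicing at a `u`-slot is `y` iff `s = y`. -/
theorem predAbove_castSucc_succ_eq_last (i₀ : Fin 2) (s : Fin (2 + 1))
    (h : Fin.predAbove (Fin.castSucc i₀) (Fin.succ s) = Fin.last 2) : s = Fin.last 2 := by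
  revert i₀ s
  decide

/-- A coordinate straightened to a `u`-letter (up to a nonzero constant) has straightening index that `u`-letter: it is not `y`. -/
theorem strIdx_ne_last_of_eq_C_mul_X {Θ' : Fin (2 + 1) → MvPowerSeries (Fin (2 + 1)) k} {l : Fin (2 + 1)} {j : Fin 2} {a : k}
    (ha : a ≠ 0) (h : Θ' l = C a * X (Fin.castSucc j)) : strIdx Θ' l ≠ Fin.last 2 := by
  classical
  intro hlast
  obtain ⟨u, -, hu⟩ := strIdx_spec (Φ := Θ') (l := l) ⟨Fin.castSucc j, C a, by rwa [constantCoeff_C], h⟩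
  rw [hlast] at hu
  have hdvd : (X (Fin.last 2) : MvPowerSeries (Fin (2 + 1)) k) ∣ Θ' l := hu ▸ Dvd.intro_left u rfl
  rw [X_dvd_iff] at hdvd
  have h0 := hdvd (Finsupp.single (Fin.castSucc j) 1) (by
    rw [Finsupp.single_apply, if_neg (Fin.castSucc_lt_last j).ne])
  rw [h, coeff_C_mul, coeff_X, if_pos rfl, mul_one] at h0
  exact ha h0

/-- **PROPAGATION OF THE OLD-LETTER INVARIANT**: after a same-head step at a `u`-slot, re-presented by coordinates `Θ′` sending
`u`-letters to `u`-letters and `y ↦ γ y`, a boundary letter of the successor straightened to `y` is OLD. -/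
theorem Decoration.old_of_strIdx_last_transform {Φ₀ : Fin (2 + 1) → MvPowerSeries (Fin (2 + 1)) k} {w : Fin (2 + 1) → ℕ}
    {pt : Fin (2 + 1) → k} {i₀ : Fin 2} (hhead : (δ.transform Φ₀ w pt (Fin.castSucc i₀)).head = δ.head)
    {Θ' : Fin (2 + 1) → MvPowerSeries (Fin (2 + 1)) k}
    (hΘ'c : ∀ i : Fin 2, ∃ (j : Fin 2) (a : k), a ≠ 0 ∧ Θ' (Fin.castSucc i) = C a * X (Fin.castSucc j))
    (hOld : ∀ l ∈ δ.E, strIdx Φ₀ l = Fin.last 2 → l ∈ δ.O) :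
    ∀ l' ∈ (δ.transform Φ₀ w pt (Fin.castSucc i₀)).E, strIdx Θ' l' = Fin.last 2 → l' ∈ (δ.transform Φ₀ w pt (Fin.castSucc i₀)).O := by
  classical
  intro l' hl' hlast
  have hl'last : l' = Fin.last 2 := by
    rcases Fin.eq_castSucc_or_eq_last l' with ⟨i, rfl⟩ | h
    · obtain ⟨j, a, ha, hΘ⟩ := hΘ'c i
      exact absurd hlast (strIdx_ne_last_of_eq_C_mul_X ha hΘ)
    · exact h
  subst hl'last
  rw [Decoration.transform_E, Finset.mem_insert] at hl'
  rcases hl' with h0 | hnew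
  · exact absurd h0.symm (Fin.last_pos'.ne)
  · rw [Decoration.O_transform_eq_of_head_eq' hhead]
    unfold Decoration.newLetters at hnew ⊢
    rw [Finset.mem_image] at hnew ⊢
    obtain ⟨l, hl, hpred⟩ := hnew
    rw [Finset.mem_filter] at hl
    have hs := predAbove_castSucc_succ_eq_last i₀ _ hpred
    exact ⟨l, Finset.mem_filter.mpr ⟨hOld l hl.1 hs, hl.2⟩, hpred⟩

end Helpers

section Curve

variable {b : MvPowerSeries (Fin (2 + 1)) k} {δ : Decoration k 2} {Φ₀ : Fin (2 + 1) → MvPowerSeries (Fin (2 + 1)) k}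
  {U : MvPowerSeries (Fin (2 + 1)) k} {d : ℕ} {A : Fin d → MvPowerSeries (Fin 2) k}

/-- **DECORATED STEP, CURVE BRANCH `V(y,u₁)`** (`k` algebraically closed): at a presented state whose label admits the curve `V(y,u₁)`
(`IsPermissibleOneT`), the curve move `(Φ₀, 𝟙_{u₁,y})` is answered, at some live slot, by an admissible successor that DROPS THE HEAD,
or keeps the head and is in the APEX COLUMN, or keeps the head and is PRESENTED by the lazy successor label `u₁^{-(d−·)}A ∈ succTWP d A`
in the polygon regime, with the old-letter invariant. -/
theorem Decoration.moveClause_presented_curveOne [IsAlgClosed k] (hadm : Admissible b δ)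
    (hperm₁ : IsBPermissible δ Φ₀ (fun _ => 1)) (hOld : ∀ l ∈ δ.E, strIdx Φ₀ l = Fin.last 2 → l ∈ δ.O)
    (hU : constantCoeff U ≠ 0) (hd : 0 < d) (hP : subst Φ₀ (δ.f * ∏ l ∈ δ.O, X l) = U * NCPoly.monicGerm d A)
    (hin : PolyDescent.InPoly d A) (ho : 2 ≤ δ.o) (h1 : PolyDescent.IsPermissibleOneT d A) :
    MoveClause b Φ₀ (fun l : Fin (2 + 1) => if l = Fin.castSucc 0 ∨ l = Fin.last 2 then (1 : ℕ) else 0)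
      (fun b' => ∃ δ' : Decoration k 2, Admissible b' δ' ∧ (δ'.head < δ.head ∨ (δ'.head = δ.head ∧ (δ'.HCol ∨
        ∃ (Θ' : Fin 3 → MvPowerSeries (Fin 3) k) (H' : MvPowerSeries (Fin 3) k) (A' : Fin d → MvPowerSeries (Fin 2) k),
          IsBPermissible δ' Θ' (fun _ => 1) ∧ (∀ l ∈ δ'.E, strIdx Θ' l = Fin.last 2 → l ∈ δ'.O) ∧ constantCoeff H' ≠ 0 ∧
          subst Θ' (δ'.f * ∏ l ∈ δ'.O, X l) = H' * NCPoly.monicGerm d A' ∧ A' ∈ PolyDescent.succTWP d A ∧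
          PolyDescent.InPoly d A')))) := by
  classical
  have hf : δ.f ≠ 0 := hadm.2.1.ne_zero
  have hdiv : ∀ j, A j = X 0 ^ (d - (j : ℕ)) * PolyDescent.divOneT d A j := fun j => PolyDescent.eq_X_pow_mul_divOneT h1 j
  have hpermw := isBPermissible_curve_of_presentation hperm₁ hf 0 hdiv hU hP
  have hcd : δ.c = d := Decoration.c_eq_of_presentation hadm hperm₁.1.1 hperm₁.1.2.1 hU hP hin.2.1
  intro pt hconv hpt Aexp G hfac hG
  by_cases hγ : pt (Fin.last 2) = 0
  · have hc0 := castSucc_ne_zero_of_curveAnswer 0 hconv hpt hγ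
    have hadm' := admissible_transform hadm hpermw hconv hfac hG hc0
    refine ⟨Fin.castSucc 0, hc0, _, hadm', ?_⟩
    rcases (Decoration.head_transform_le hpermw hconv hf hc0).lt_or_eq with hlt | heq
    · exact Or.inl hlt
    · refine Or.inr ⟨heq, ?_⟩
      have hnear := Decoration.o_transform_eq_of_head_eq' heq
      obtain ⟨Θ', H', hperm', hΘ'c, -, hH', hP'⟩ :=
        Decoration.presentation_curveSucc_zero hperm₁ hf hU hdiv hP hconv hγ hc0 hnear
      have hWP' := PolyDescent.wellPrepared_divOneT A h1 hin.1
      by_cases hin' : PolyDescent.InPoly d (PolyDescent.divOneT d A)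
      · refine Or.inr ⟨Θ', H', PolyDescent.divOneT d A, hperm', Decoration.old_of_strIdx_last_transform heq hΘ'c hOld, hH', hP',
          ?_, hin'⟩
        rw [PolyDescent.succTWP, PolyDescent.succTSel_of_isPermissibleOneT _ h1]
        exact Set.mem_singleton _
      · exact Or.inl (Decoration.hCol_of_presentation_of_not_inPoly hadm' hperm'.1.1 hperm'.1.2.1 hperm'.2.2.2 hH' hd hP'
          ((Decoration.c_transform_eq_of_head_eq' heq).trans hcd) (hnear.symm ▸ ho) hWP' hin')
  · have hγ0 : pt (Fin.last 2) ≠ 0 := hγ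
    have hadm' := admissible_transform hadm hpermw hconv hfac hG hγ0
    refine ⟨Fin.last 2, hγ0, _, hadm', Or.inl (Decoration.head_transform_lt_of_o_lt ?_)⟩
    rw [o_transform_curve_eq_zero_of_gamma_ne_zero' hperm₁ hf hU hin.2.1 hP hdiv hconv hγ0 (Fin.last 2)]
    omega

/-- **DECORATED STEP, CURVE BRANCH `V(y,u₂)`**: the same for the curve `V(y,u₂)` (`IsPermissibleTwoT`, `V(y,u₁)` not permissible — the
lazy strategy prefers `u₁`), successor label `u₂^{-(d−·)}A`. -/
theorem Decoration.moveClause_presented_curveTwo [IsAlgClosed k] (hadm : Admissible b δ)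
    (hperm₁ : IsBPermissible δ Φ₀ (fun _ => 1)) (hOld : ∀ l ∈ δ.E, strIdx Φ₀ l = Fin.last 2 → l ∈ δ.O)
    (hU : constantCoeff U ≠ 0) (hd : 0 < d) (hP : subst Φ₀ (δ.f * ∏ l ∈ δ.O, X l) = U * NCPoly.monicGerm d A)
    (hin : PolyDescent.InPoly d A) (ho : 2 ≤ δ.o) (h1 : ¬ PolyDescent.IsPermissibleOneT d A) (h2 : PolyDescent.IsPermissibleTwoT d A) :
    MoveClause b Φ₀ (fun l : Fin (2 + 1) => if l = Fin.castSucc 1 ∨ l = Fin.last 2 then (1 : ℕ) else 0)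
      (fun b' => ∃ δ' : Decoration k 2, Admissible b' δ' ∧ (δ'.head < δ.head ∨ (δ'.head = δ.head ∧ (δ'.HCol ∨
        ∃ (Θ' : Fin 3 → MvPowerSeries (Fin 3) k) (H' : MvPowerSeries (Fin 3) k) (A' : Fin d → MvPowerSeries (Fin 2) k),
          IsBPermissible δ' Θ' (fun _ => 1) ∧ (∀ l ∈ δ'.E, strIdx Θ' l = Fin.last 2 → l ∈ δ'.O) ∧ constantCoeff H' ≠ 0 ∧
          subst Θ' (δ'.f * ∏ l ∈ δ'.O, X l) = H' * NCPoly.monicGerm d A' ∧ A' ∈ PolyDescent.succTWP d A ∧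
          PolyDescent.InPoly d A')))) := by
  classical
  have hf : δ.f ≠ 0 := hadm.2.1.ne_zero
  have hdiv : ∀ j, A j = X 1 ^ (d - (j : ℕ)) * PolyDescent.divTwoT d A j := fun j => PolyDescent.eq_X_pow_mul_divTwoT h2 j
  have hpermw := isBPermissible_curve_of_presentation hperm₁ hf 1 hdiv hU hP
  have hcd : δ.c = d := Decoration.c_eq_of_presentation hadm hperm₁.1.1 hperm₁.1.2.1 hU hP hin.2.1
  intro pt hconv hpt Aexp G hfac hG
  by_cases hγ : pt (Fin.last 2) = 0
  · have hc1 := castSucc_ne_zero_of_curveAnswer 1 hconv hpt hγ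
    have hadm' := admissible_transform hadm hpermw hconv hfac hG hc1
    refine ⟨Fin.castSucc 1, hc1, _, hadm', ?_⟩
    rcases (Decoration.head_transform_le hpermw hconv hf hc1).lt_or_eq with hlt | heq
    · exact Or.inl hlt
    · refine Or.inr ⟨heq, ?_⟩
      have hnear := Decoration.o_transform_eq_of_head_eq' heq
      obtain ⟨Θ', H', hperm', hΘ'c, -, hH', hP'⟩ :=
        Decoration.presentation_curveSucc_one hperm₁ hf hU hdiv hP hconv hγ hc1 hnear
      have hWP' := PolyDescent.wellPrepared_divTwoT A h2 hin.1
      by_cases hin' : PolyDescent.InPoly d (PolyDescent.divTwoT d A)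
      · refine Or.inr ⟨Θ', H', PolyDescent.divTwoT d A, hperm', Decoration.old_of_strIdx_last_transform heq hΘ'c hOld, hH', hP',
          ?_, hin'⟩
        rw [PolyDescent.succTWP, PolyDescent.succTSel_of_isPermissibleTwoT _ h1 h2]
        exact Set.mem_singleton _
      · exact Or.inl (Decoration.hCol_of_presentation_of_not_inPoly hadm' hperm'.1.1 hperm'.1.2.1 hperm'.2.2.2 hH' hd hP'
          ((Decoration.c_transform_eq_of_head_eq' heq).trans hcd) (hnear.symm ▸ ho) hWP' hin')
  · have hγ0 : pt (Fin.last 2) ≠ 0 := hγ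
    have hadm' := admissible_transform hadm hpermw hconv hfac hG hγ0
    refine ⟨Fin.last 2, hγ0, _, hadm', Or.inl (Decoration.head_transform_lt_of_o_lt ?_)⟩
    rw [o_transform_curve_eq_zero_of_gamma_ne_zero' hperm₁ hf hU hin.2.1 hP hdiv hconv hγ0 (Fin.last 2)]
    omega

end Curve

end TameFourTupleDrop

end Summit.ResolutionOfSingularities.ResolutionOfSingularities.Theorems

end
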